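import Summits.BirchSwinnertonDyer.BirchSwinnertonDyer.Theorems.ThetaPartnerAtTwoSignedControlAtTwoShaTwoArchMoves
import Summits.BirchSwinnertonDyer.BirchSwinnertonDyer.Theorems.ThetaPartnerAtTwoSignedControlAtTwoArchMovesOfDiscriminantNeg
import HarnessLib

/-!
# K4 `SignedControlAtTwo`: `Ш²(ℚ, E[2^∞]) = 0` and the crux body for the curves with NEGATIVE DISCRIMINANT, from PT(b) + PT(a)

Crux K4 `SignedControlAtTwo` (stmt-BirchSwinnertonDyer-20309; routes `ThetaPartnerAtTwo` / `ResidualThetaTransportAtTwo`), line `eulerchar`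
v12; width seat `bsd-wall-tp2-p3-w3` g8 (`--supports stmt-BirchSwinnertonDyer-20309`, helper).  The cone half of
`…ArchMovesOfDiscriminantNeg.lean`: the doors of `…ShaTwoArchMoves.lean` (binder «`Γ_{ℚ_∞}` moves `E[2]`») re-keyed on `W.Δ < 0`
through `SignedEC.ArchMoves.exists_toLocal_twoTorsion_ne_of_discriminant_neg`:

* `forall_mem_shaTwo_two_primary_eq_zero_of_goodSS_of_discriminant_neg` — `Ш²(ℚ, E[2^∞]) = 0` for `GoodSS W 2`, `Sel_{2^∞}` finite,
  `Δ < 0`, from `poitouTate_sha_tateDual ℚ` ALONE;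
* **`signedControl_body_of_discriminant_neg`** — both conjuncts of the crux for `GoodSS W 2`, `a₂ = 0`, `Δ(W) < 0`, from
  `poitouTate_selmerStructure_duality ℚ` and `poitouTate_sha_tateDual ℚ` (the v12 residue {PT(b), PT(a), 4.10(c)₃, 4.16} is {PT(b), PT(a)}
  on the negative-discriminant half of the row).

HONEST FRAMING: THEOREMS only (no definition, no named fact, no `sorry`); CONDITIONAL on the two cited Poitou–Tate facts (hypotheses);
closes no item; BSD is not proved by any of this.

References: [MilneADT2006] I Thm. 4.10, Cor. 4.16, Thm. 6.13 (c); [GreenbergLNM1716] §4 p. 119; [BDKim2013] Cor. 3.15; [Kobayashi2003] Thm. 1.2.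
-/

set_option autoImplicit false
-- the Theorems namespace of this sub repeats the summit name by design (D-0017 nested layout)
set_option linter.dupNamespace false

noncomputable section

namespace Summit.BirchSwinnertonDyer.BirchSwinnertonDyer.Theorems.SignedEC.ShaTwoArchMoves

open Field NumberField WeierstrassCurve Literature.NumberTheory.GaloisRepresentations
open Literature.NumberTheory.EllipticCurves Literature.NumberTheory.GaloisCohomology
open Literature.NumberTheory.GaloisRepresentations.DiscreteGaloisModule (shaTwo)
open Summit.BirchSwinnertonDyer.Rank1Residual.X11b (LocBridge.primaryGaloisModule)
open Summit.BirchSwinnertonDyer.BirchSwinnertonDyer.Theorems.SignedEC.ArchMoves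

variable (W : WeierstrassCurve ℚ) [W.IsElliptic] [W.IsGloballyMinimal]

/-- **`Ш²(ℚ, E[2^∞]) = 0` for `GoodSS W 2`, `Sel_{2^∞}(E/ℚ)` finite and `Δ(E) < 0`, from `poitouTate_sha_tateDual ℚ` ALONE.**
[cite: MilneADT2006, Ch. I, Thm. 4.10, Cor. 4.16, Thm. 6.13 (c)] [cite: GreenbergLNM1716, §4 p. 119] -/
theorem forall_mem_shaTwo_two_primary_eq_zero_of_goodSS_of_discriminant_neg
    (hss : Literature.NumberTheory.EllipticCurves.Rank1Residual.GoodSS W 2) (hPT : poitouTate_sha_tateDual ℚ) (hΔ : W.Δ < 0)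
    [Finite (W.selmerGroupPInfty 2)] : ∀ c ∈ shaTwo (LocBridge.primaryGaloisModule W 2), c = 0 :=
  forall_mem_shaTwo_two_primary_eq_zero_of_goodSS_of_moves W hss hPT Rat.infinitePlace
    (exists_toLocal_twoTorsion_ne_of_discriminant_neg W hΔ Rat.infinitePlace)

/-- **K4 body for the curves of the row with NEGATIVE DISCRIMINANT, from PT(b) and PT(a) alone** (`GoodSS W 2`, `a₂ = 0`,
`Δ(W) < 0`; `signedControl_body_of_moves` with `hmove` discharged by `exists_toLocal_twoTorsion_ne_of_discriminant_neg`).  Conditional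
on the cited `poitouTate_selmerStructure_duality ℚ`, `poitouTate_sha_tateDual ℚ`; closes no item. [cite: MilneADT2006, Ch. I, Thm. 4.10 (a)(b)]
[cite: BDKim2013, Cor. 3.15] [cite: Kobayashi2003, Thm. 1.2] -/
theorem signedControl_body_of_discriminant_neg (hPTb : poitouTate_selmerStructure_duality ℚ) (hPTa : poitouTate_sha_tateDual ℚ)
    (hss : Literature.NumberTheory.EllipticCurves.Rank1Residual.GoodSS W 2) (ha : W.frobeniusTrace 2 = 0) (hΔ : W.Δ < 0) :
    (∀ (κ : ZpExtension ℚ 2) (γ : Field.absoluteGaloisGroup ℚ), κ.IsCyclotomic → κ.IsTopGenerator γ →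
        ∀ D : Kobayashi2003.SignedSelmerDualData W κ γ 1, Module.Finite (IwasawaAlgebra 2) D.X) ∧
      (∀ (κ : ZpExtension ℚ 2) (γ : Field.absoluteGaloisGroup ℚ), κ.IsCyclotomic → κ.IsTopGenerator γ →
        ∀ (D : Kobayashi2003.SignedSelmerDualData W κ γ 1) [Module.Finite (IwasawaAlgebra 2) D.X],
          Module.IsTorsion (IwasawaAlgebra 2) D.X → ∀ g : IwasawaAlgebra 2, D.charIdeal = Ideal.span {g} →
          Finite (W.selmerGroupPInfty 2) →
          ∃ u : ℤ_[2]ˣ, ((PowerSeries.constantCoeff g : ℤ_[2]) : ℚ_[2]) =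
            ((u : ℤ_[2]) : ℚ_[2]) * ((2 : ℕ) : ℚ_[2]) ^ (padicValNat 2 W.tamagawaProduct) *
              (Nat.card (W.selmerGroupPInfty 2) : ℚ_[2])) :=
  signedControl_body_of_moves hPTb hPTa W hss ha Rat.infinitePlace
    (exists_toLocal_twoTorsion_ne_of_discriminant_neg W hΔ Rat.infinitePlace)

end Summit.BirchSwinnertonDyer.BirchSwinnertonDyer.Theorems.SignedEC.ShaTwoArchMoves

end
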